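import Literature.Computability.AlgebraicComplexity.STPPLineFamilies
import HarnessLib

/-!
# STPP families of size pattern (2,1,1): the COSET LAW (any abelian group, any subgroup)

Cell `pub-omega` (unit `pub-omega-stpp-1-g36`), topic `Summits/MatrixMultiplication/OmegaCensus`.
HONEST FRAMING (verbatim): lottery ticket; floor = certified bounds/negative ranges. Census STRUCTURE bookkeeping (the threshold column
`T1(H) = max {k : (2,1,1)^k ⊆ H}`; mechanism class of X-38 / Pb237); nothing here is a bound on `ω`.

A `(2,1,1)^k` family in translation normal form is `Aᵢ` (the 2-sets), `Bᵢ = {0}`, `Cᵢ = {cᵢ}`. CKSU Def. 5.1 for it is the PAIRWISE LAW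
(`nf_pairwise`): two distinct labeled `A`-points `(x, i) ≠ (y, l)` satisfy `x − y ≠ cⱼ − c_l` for every `j` (the word
`(x − y) + (0 − 0) + (c_l − cⱼ)` with index pattern `(i, j, l)`). Consequently, for ANY subgroup `W ≤ H` and any base point `g`, the
labeled points of the coset `g + W`, translated by `−g`, form a **`W`-admissible labeled set** (`Adm`: points in `W`, the pairwise law,
`adm_slice`) in which label `i` occurs at most `#Aᵢ` times (`card_label_slice_le`). When `W` has index two, the two slices at `g₀` and
at a point `g₁` of the other coset carry all `Σ #Aᵢ` labeled points (`sum_card_le_two_slices`); choosing `g₀ ∈ A₀` and `g₁` in a block of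
least label among the blocks meeting the other coset puts `(0, label)` into each slice with all labels `≥` it (`exists_rooted_slices`).
**THE COSET LAW** (`no_family_of_coset_bound`): if every rooted `W`-admissible labeled set with multiplicities `≤ 2` has fewer than `T`
members and `0 < T ≤ k`, then NO normal-form `(2,1,1)^k` family with these `c`'s exists. (When all `cᵢ ∈ W` the admissible sets are
small — points of different cosets never interact — which is how the law kills 18 of the 29 affine classes of 10-point `c`-sets of
`𝔽₂⁶`; the bound itself is a kernel computation, files `STPP211Coset*`.) General `H`, general `W`; no computation here.

References: H. Cohn, R. Kleinberg, B. Szegedy, C. Umans, FOCS 2005 (arXiv:math/0511460), Def. 5.1.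
-/

namespace Summit.MatrixMultiplication.OmegaCensus

namespace T1Coset

open Finset Literature.Computability.AlgebraicComplexity

variable {H : Type*} [AddCommGroup H] [DecidableEq H] {k : ℕ}

/-! ## The pairwise law of a normal-form family -/

omit [DecidableEq H] in
/-- **Pairwise law.** In an STPP family `(Aᵢ, {0}, {cᵢ})`, two distinct labeled `A`-points `(x, i) ≠ (y, l)` have `x − y ≠ cⱼ − c_l`
for every `j` (CKSU Def. 5.1 with `s' = x`, `s = y`, `t = t' = 0`, `u = cⱼ`, `u' = c_l`). [cite: CohnKleinbergSzegedyUmans2005, Def. 5.1] -/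
theorem nf_pairwise {A : Fin k → Finset H} {c : Fin k → H} (hS : IsSTPP A (fun _ => ({0} : Finset H)) (fun i => {c i}))
    {i l : Fin k} {x y : H} (hx : x ∈ A i) (hy : y ∈ A l) (hne : (x, i) ≠ (y, l)) (j : Fin k) : x - y ≠ c j - c l := by
  intro he
  have hw := hS i j l y hy x hx 0 (mem_singleton_self _) 0 (mem_singleton_self _) (c j) (mem_singleton_self _) (c l)
    (mem_singleton_self _) (by rw [he]; abel)
  obtain ⟨hij, hjl, hyx, -, -⟩ := hw
  exact hne (by rw [hyx, hij, hjl])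

omit [DecidableEq H] in
/-- The `c`'s of a normal-form family with non-empty `A`'s are pairwise distinct. [cite: CohnKleinbergSzegedyUmans2005, Def. 5.1] -/
theorem c_injective {A : Fin k → Finset H} {c : Fin k → H} (hS : IsSTPP A (fun _ => ({0} : Finset H)) (fun i => {c i}))
    (hA : ∀ i, (A i).Nonempty) : Function.Injective c := by
  intro i j hij
  obtain ⟨s, hs⟩ := hA i
  have hw := hS i j i s hs s hs 0 (mem_singleton_self _) 0 (mem_singleton_self _) (c j) (mem_singleton_self _) (c i)
    (mem_singleton_self _) (by rw [hij]; abel)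
  exact hw.1

/-! ## Labeled points, admissible labeled sets, slices -/

/-- A **`W`-admissible labeled set** for the `c`-list `c`: members `(x, i)` with `x ∈ W`, and any two distinct members `(x, i) ≠ (y, l)`
have `x − y ≠ cⱼ − c_l` for every `j`. -/
def Adm (W : AddSubgroup H) (c : Fin k → H) (Q : Finset (H × Fin k)) : Prop :=
  (∀ p ∈ Q, p.1 ∈ W) ∧ ∀ p ∈ Q, ∀ q ∈ Q, p ≠ q → ∀ j, p.1 - q.1 ≠ c j - c q.2

/-- The labeled `A`-points `(x, i)`, `x ∈ Aᵢ`, of a family. -/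
def pts (A : Fin k → Finset H) : Finset (H × Fin k) := univ.biUnion fun i => (A i).image fun x => (x, i)

omit [AddCommGroup H] in
/-- Membership in `pts`. -/
theorem mem_pts {A : Fin k → Finset H} {p : H × Fin k} : p ∈ pts A ↔ p.1 ∈ A p.2 := by
  constructor
  · intro hp
    obtain ⟨i, -, hi⟩ := mem_biUnion.1 hp
    obtain ⟨x, hx, rfl⟩ := mem_image.1 hi
    exact hx
  · intro hp
    exact mem_biUnion.2 ⟨p.2, mem_univ _, mem_image.2 ⟨p.1, hp, rfl⟩⟩

omit [AddCommGroup H] in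
/-- `pts` has `Σᵢ #Aᵢ` members. -/
theorem card_pts (A : Fin k → Finset H) : (pts A).card = ∑ i, (A i).card := by
  rw [pts, card_biUnion]
  · exact sum_congr rfl fun i _ => card_image_of_injective _ fun x y h => (Prod.ext_iff.1 h).1
  · intro i _ j _ hij
    rw [Function.onFun, disjoint_left]
    intro p hpi hpj
    obtain ⟨x, -, rfl⟩ := mem_image.1 hpi
    obtain ⟨y, -, hy⟩ := mem_image.1 hpj
    exact hij (Prod.ext_iff.1 hy).2.symm

variable (W : AddSubgroup H) [DecidablePred (· ∈ W)]

/-- The **slice** of a family at the base point `g`: the labeled `A`-points of the coset `g + W`, translated by `−g`. -/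
def slice (A : Fin k → Finset H) (g : H) : Finset (H × Fin k) :=
  ((pts A).filter fun p => p.1 - g ∈ W).image fun p => (p.1 - g, p.2)

variable {W}

/-- Membership in a slice. -/
theorem mem_slice {A : Fin k → Finset H} {g : H} {q : H × Fin k} : q ∈ slice W A g ↔ q.1 + g ∈ A q.2 ∧ q.1 ∈ W := by
  rw [slice, mem_image]
  constructor
  · rintro ⟨p, hp, rfl⟩
    rw [mem_filter, mem_pts] at hp
    exact ⟨by rw [sub_add_cancel]; exact hp.1, hp.2⟩
  · rintro ⟨h1, h2⟩
    refine ⟨(q.1 + g, q.2), mem_filter.2 ⟨mem_pts.2 h1, by rw [add_sub_cancel_right]; exact h2⟩, ?_⟩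
    rw [add_sub_cancel_right]

/-- A slice has as many members as there are labeled points in its coset. -/
theorem card_slice (A : Fin k → Finset H) (g : H) : (slice W A g).card = ((pts A).filter fun p => p.1 - g ∈ W).card :=
  card_image_of_injective _ fun p q h => by
    have h' := Prod.ext_iff.1 h
    exact Prod.ext (sub_left_injective h'.1) h'.2

/-- **Slices are admissible.** [cite: CohnKleinbergSzegedyUmans2005, Def. 5.1] -/
theorem adm_slice {A : Fin k → Finset H} {c : Fin k → H} (hS : IsSTPP A (fun _ => ({0} : Finset H)) (fun i => {c i})) (g : H) :
    Adm W c (slice W A g) := by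
  refine ⟨fun p hp => (mem_slice.1 hp).2, fun p hp q hq hpq j he => ?_⟩
  obtain ⟨hp1, -⟩ := mem_slice.1 hp
  obtain ⟨hq1, -⟩ := mem_slice.1 hq
  have hne : (p.1 + g, p.2) ≠ (q.1 + g, q.2) := fun e => hpq (Prod.ext (add_right_cancel (Prod.ext_iff.1 e).1) (Prod.ext_iff.1 e).2)
  exact nf_pairwise hS hp1 hq1 hne j (by rw [← he]; abel)

/-- **Multiplicity:** label `i` occurs at most `#Aᵢ` times in a slice. -/
theorem card_label_slice_le (A : Fin k → Finset H) (g : H) (i : Fin k) :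
    ((slice W A g).filter fun q => q.2 = i).card ≤ (A i).card := by
  refine card_le_card_of_injOn (fun q => q.1 + g) (fun q hq => ?_) (fun q hq q' hq' h => ?_)
  · rw [mem_coe, mem_filter] at hq
    rw [mem_coe, ← hq.2]; exact (mem_slice.1 hq.1).1
  · rw [mem_coe, mem_filter] at hq hq'
    exact Prod.ext (add_right_cancel h) (hq.2.trans hq'.2.symm)

/-- **Root:** if `g ∈ Aᵢ` then `(0, i)` is in the slice at `g`. -/
theorem zero_mem_slice {A : Fin k → Finset H} {g : H} {i : Fin k} (hg : g ∈ A i) : ((0 : H), i) ∈ slice W A g :=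
  mem_slice.2 ⟨by rw [zero_add]; exact hg, W.zero_mem⟩

/-- **One coset:** if every `A`-point lies in `g + W`, the slice at `g` carries all `Σ #Aᵢ` labeled points. -/
theorem card_slice_of_all {A : Fin k → Finset H} {g : H} (hall : ∀ i, ∀ x ∈ A i, x - g ∈ W) :
    (slice W A g).card = ∑ i, (A i).card := by
  rw [card_slice, ← card_pts, filter_true_of_mem fun p hp => hall p.2 p.1 (mem_pts.1 hp)]

/-- **Two cosets (index two):** if any two elements outside `W` differ by an element of `W` and `g₁ − g₀ ∉ W`, the slices at `g₀` and
`g₁` together carry all `Σ #Aᵢ` labeled points. -/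
theorem sum_card_le_two_slices (hW2 : ∀ a b : H, a ∉ W → b ∉ W → a - b ∈ W) {A : Fin k → Finset H} {g₀ g₁ : H}
    (hg : g₁ - g₀ ∉ W) : ∑ i, (A i).card ≤ (slice W A g₀).card + (slice W A g₁).card := by
  rw [card_slice, card_slice, ← card_pts, ← card_union_of_disjoint]
  · refine card_le_card fun p hp => ?_
    rw [mem_union, mem_filter, mem_filter]
    by_cases h0 : p.1 - g₀ ∈ W
    · exact Or.inl ⟨hp, h0⟩
    · refine Or.inr ⟨hp, ?_⟩
      have := hW2 _ _ h0 hg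
      rwa [sub_sub_sub_cancel_right] at this
  · rw [disjoint_left]
    intro p hp0 hp1
    have h0 := (mem_filter.1 hp0).2
    have h1 := (mem_filter.1 hp1).2
    have : (p.1 - g₀) - (p.1 - g₁) ∈ W := W.sub_mem h0 h1
    rw [sub_sub_sub_cancel_left] at this
    exact hg this

/-! ## The coset law -/

/-- The shape of the kernel bound: every `W`-admissible labeled set with multiplicities `≤ 2`, containing a root `(0, i₀)` whose label is
least among its members, has fewer than `T` members. -/
def CosetBound (W : AddSubgroup H) (c : Fin k → H) (T : ℕ) : Prop :=
  ∀ Q : Finset (H × Fin k), Adm W c Q → (∀ i, (Q.filter fun q => q.2 = i).card ≤ 2) →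
    ∀ i₀, ((0 : H), i₀) ∈ Q → (∀ q ∈ Q, i₀ ≤ q.2) → Q.card < T

/-- **THE COSET LAW.** If `W` has index at most two (`hW2`), the kernel bound `CosetBound W c T` holds and `0 < T ≤ k`, then there is
NO STPP family `(Aᵢ, {0}, {cᵢ})` with all `#Aᵢ = 2`. [cite: CohnKleinbergSzegedyUmans2005, Def. 5.1] -/
theorem no_family_of_coset_bound (hW2 : ∀ a b : H, a ∉ W → b ∉ W → a - b ∈ W) {c : Fin k → H} {T : ℕ}
    (hB : CosetBound W c T) (hT0 : 0 < T) (hTk : T ≤ k) :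
    ¬ ∃ A : Fin k → Finset H, IsSTPP A (fun _ => ({0} : Finset H)) (fun i => {c i}) ∧ ∀ i, (A i).card = 2 := by
  rintro ⟨A, hS, hcard⟩
  have hk : 0 < k := hT0.trans_le hTk
  have hsum : ∑ i, (A i).card = 2 * k := by
    rw [sum_congr rfl fun i _ => hcard i, sum_const, card_univ, Fintype.card_fin, smul_eq_mul, mul_comm]
  have hmult : ∀ g i, ((slice W A g).filter fun q => q.2 = i).card ≤ 2 := fun g i =>
    (card_label_slice_le A g i).trans (hcard i).le
  -- the first root: a point of block `0`
  set i₀ : Fin k := ⟨0, hk⟩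
  obtain ⟨g₀, hg₀⟩ : (A i₀).Nonempty := card_pos.1 (by rw [hcard]; norm_num)
  have hS0 : (slice W A g₀).card < T :=
    hB _ (adm_slice hS g₀) (hmult g₀) i₀ (zero_mem_slice hg₀) fun q _ => Fin.mk_le_of_le_val (Nat.zero_le _)
  by_cases hall : ∀ i, ∀ x ∈ A i, x - g₀ ∈ W
  · have := card_slice_of_all (W := W) hall
    omega
  · -- the second root: a point of least label among the blocks meeting the other coset
    simp only [not_forall, exists_prop] at hall
    have hex : ∃ n, ∃ i : Fin k, i.val = n ∧ ∃ x ∈ A i, x - g₀ ∉ W := by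
      obtain ⟨i, x, hx, hxW⟩ := hall
      exact ⟨i.val, i, rfl, x, hx, hxW⟩
    obtain ⟨i₁, hi₁n, g₁, hg₁, hg₁W⟩ := Nat.find_spec hex
    have hmin : ∀ i : Fin k, ∀ x ∈ A i, x - g₀ ∉ W → i₁ ≤ i := by
      intro i x hx hxW
      have := Nat.find_min' hex ⟨i, rfl, x, hx, hxW⟩
      rw [← hi₁n] at this
      exact this
    have hS1 : (slice W A g₁).card < T := by
      refine hB _ (adm_slice hS g₁) (hmult g₁) i₁ (zero_mem_slice hg₁) fun q hq => ?_
      obtain ⟨hq1, hq2⟩ := mem_slice.1 hq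
      refine hmin q.2 (q.1 + g₁) hq1 fun hW => hg₁W ?_
      have : (q.1 + g₁ - g₀) - q.1 ∈ W := W.sub_mem hW hq2
      rwa [add_sub_assoc, add_sub_cancel_left] at this
    have h2 := sum_card_le_two_slices hW2 (A := A) hg₁W
    omega

/-- **Sub-family form.** The coset law applied to the blocks selected by an injection `ι : Fin k' → Fin k`: if the kernel bound holds for
the selected `c`'s with `0 < T ≤ k'`, there is no STPP family `(Aᵢ, {0}, {cᵢ})` with all `#Aᵢ = 2`.
[cite: CohnKleinbergSzegedyUmans2005, Def. 5.1] -/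
theorem no_family_of_coset_bound_sub (hW2 : ∀ a b : H, a ∉ W → b ∉ W → a - b ∈ W) {c : Fin k → H} {k' : ℕ}
    (ι : Fin k' → Fin k) (hι : Function.Injective ι) {T : ℕ} (hB : CosetBound W (fun i => c (ι i)) T) (hT0 : 0 < T)
    (hTk : T ≤ k') : ¬ ∃ A : Fin k → Finset H, IsSTPP A (fun _ => ({0} : Finset H)) (fun i => {c i}) ∧ ∀ i, (A i).card = 2 := by
  rintro ⟨A, hS, hcard⟩
  exact no_family_of_coset_bound hW2 hB hT0 hTk ⟨fun i => A (ι i), hS.comp_of_injective ι hι, fun i => hcard (ι i)⟩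

end T1Coset

end Summit.MatrixMultiplication.OmegaCensus
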